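import Summits.Langlands.Langlands.Theses.EmbeddingNecklace
import Literature.NumberTheory.Automorphic.PDAutomorphyLiftingGL2TotallyReal
import HarnessLib.Audit.Check

/-!
# Line `pd_transfer` for crux `DeRhamLiftingIrred` (stmt-Langlands-18132) — transfer to POTENTIAL
# DIAGONALISABILITY at the places above `p` (Galois side), Barnet-Lamb–Gee–Geraghty–Taylor lifting

Crux-strategist ALTERNATIVE line (does not replace the registered skeleton `Lines/birth.lean`).
Skeleton: three registered stubs and the kernel-checked composition `DeRhamLiftingIrred_of`
(sorries only inside `stub_*`).  See `Lines/pd_transfer.md` for the line card.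

* `stub_pdLocal`   — LOCAL, OPEN (hardest): every `ρ|Γ_(F_v)` in the crux's local situation (`p ≥ 5`
  unramified in `F`, de Rham for Fontaine's pinned datum with two distinct `τ`-labelled Hodge–Tate weights
  for every `τ`, residually absolutely irreducible) is POTENTIALLY DIAGONALISABLE (BLGGT §1.4) for every
  instance of compatible crystalline extension data over the pinned datum (and such an instance exists).
* `stub_pdLift`    — GLOBAL, IN PRINT for `p ≥ 7` (BLGGT 2014 Thm 4.2.1 in Dieulefait–Pacetti's totally
  real form Thm 8.11, potentially crystalline case, + existence of a potentially Barsotti–Tate, hence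
  potentially diagonalisable, automorphic lift of level potentially prime to `p` of the modular `ρ̄`:
  Barnet-Lamb–Gee–Geraghty MRL 20 (2013) / Gee–Kisin 2014 Lemma 4.4.1 / Breuil–Diamond 2014 Thm 3.2.2):
  the crux with `7 ≤ p` and the extra hypothesis "`ρ|Γ_(F_v)` potentially diagonalisable at every `v ∣ p`".
* `stub_pFive`     — the crux at `p = 5` (sector corner: BLGGT's `l ≥ 2(d+1)` and Thorne adequacy fail for
  residual images meeting `SL₂(𝔽₅)`; Kisin's proviso `[F(ζ₅):F] = 4` is absent from the crux).
-/

namespace Summit.Langlands.Langlands.Cruxes.DeRhamLiftingIrred.PdTransfer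

open scoped BigOperators Topology Classical Matrix

/-- stub (sector corner, rank 3): the crux `DeRhamLiftingIrred` at `p = 5`.  Non-exceptional residual
images (`5 ∤ #im ρ̄`, or projective image `PGL₂(𝔽₅)` with `[F(ζ₅):F] = 4`) follow the PD chain of the other
two stubs with the `GL₂`-specific Taylor–Wiles condition; the exceptional corner (`√5 ∈ F`, projective image
`PGL₂(𝔽₅)`) is outside every patching theorem in print. -/
theorem stub_pFive : ∀ (F : Type) [Field F] [NumberField F], NumberField.IsTotallyReal F → ∀ (p : ℕ) [Fact p.Prime], p = 5 → ¬ ((p : ℤ) ∣ NumberField.discr F) → ∀ (hcpt : Literature.NumberTheory.Automorphic.isCompact_glFiniteIntegralLevel 2 F) (ι : PadicAlgCl p ≃+* ℂ) (ρ : Literature.NumberTheory.GaloisRepresentations.FramedGaloisRep F (PadicAlgCl p) 2), ρ.toGaloisRep.IsIrreducible → (∀ᶠ v : IsDedekindDomain.HeightOneSpectrum (NumberField.RingOfIntegers F) in Filter.cofinite, ρ.IsUnramifiedAt v) → ρ.IsOdd → (∀ (v : IsDedekindDomain.HeightOneSpectrum (NumberField.RingOfIntegers F)) (hv : ((p : ℕ)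 : NumberField.RingOfIntegers F) ∈ v.asIdeal), (Literature.NumberTheory.PAdicHodge.fontainePstAdicCompletion v p hv).IsDeRhamFramed (ρ.toLocal v) ∧ ∀ τ : @AlgHom ℚ_[p] (v.adicCompletion F) (PadicAlgCl p) _ _ _ (Literature.NumberTheory.PAdicHodge.fontainePstAdicCompletion v p hv).algebra _, (ρ.labelledHodgeTateWeightsAt v (Literature.NumberTheory.PAdicHodge.fontainePstAdicCompletion v p hv).algebra (Literature.NumberTheory.PAdicHodge.fontainePstAdicCompletion v p hv).𝔅 (@AlgHom.toRingHom ℚ_[p] (v.adicCompletion F) (PadicAlgCl p) _ _ _ (Literature.NumberTheory.PAdicHodge.fontainePstAdicCompletion v p hv).algebra _ τ)).Nodup ∧ Multiset.card (ρ.labelledHodgeTateWeightsAt v (Literature.NumberTheory.PAdicHodge.fontainePstAdicCompletion v p hv).algebra (Literature.NumberTheory.PAdicHodge.fontainePstAdicCompletion v p hv).𝔅 (@AlgHom.toRingHom ℚ_[p] (v.adicCompletion F) (PadicAlgCl p) _ _ _ (Literature.NumberTheory.PAdicHodge.fontainePstAdicCompletion v p hv).algebra _ τ)) = 2) → (∀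 v : IsDedekindDomain.HeightOneSpectrum (NumberField.RingOfIntegers F), ((p : ℕ) : NumberField.RingOfIntegers F) ∈ v.asIdeal → ¬ ∃ χ₁ χ₂ : Field.absoluteGaloisGroup (v.adicCompletion F) →* (PadicAlgCl p)ˣ, IsOpen (χ₁.ker : Set (Field.absoluteGaloisGroup (v.adicCompletion F))) ∧ IsOpen (χ₂.ker : Set (Field.absoluteGaloisGroup (v.adicCompletion F))) ∧ ∀ σ, ‖(ρ.toLocal v σ).val.trace - ((χ₁ σ : PadicAlgCl p) + (χ₂ σ : PadicAlgCl p))‖ < 1) → (¬ ∃ χ₁ χ₂ : Field.absoluteGaloisGroup (CyclotomicField p F) →* (PadicAlgCl p)ˣ, IsOpen (χ₁.ker : Set (Field.absoluteGaloisGroup (CyclotomicField p F))) ∧ IsOpen (χ₂.ker : Set (Field.absoluteGaloisGroup (CyclotomicField p F))) ∧ ∀ σ, ‖(ρ.restrictField (CyclotomicField p F) σ).val.trace - ((χ₁ σ : PadicAlgCl p) + (χ₂ σ : PadicAlgCl p))‖ < 1) → (∃ (π₀ : Literature.NumberTheory.Automorphic.CuspidalAutomorphicRepData 2 F hcpt)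 (ρ₀ : Literature.NumberTheory.GaloisRepresentations.FramedGaloisRep F (PadicAlgCl p) 2), π₀.1.IsLAlgebraic ∧ (∃ T : Literature.NumberTheory.Automorphic.InfinityType F 2, π₀.1.HasInfinityType T ∧ T.IsRegular) ∧ Literature.NumberTheory.Automorphic.SatakeFrobCompatibleAE ι π₀.1 ρ₀ ∧ ∀ σ, ‖(ρ σ).val.trace - (ρ₀ σ).val.trace‖ < 1) → ∃ π : Literature.NumberTheory.Automorphic.CuspidalAutomorphicRepData 2 F hcpt, π.1.IsLAlgebraic ∧ (∃ T : Literature.NumberTheory.Automorphic.InfinityType F 2, π.1.HasInfinityType T ∧ T.IsRegular) ∧ Literature.NumberTheory.Automorphic.SatakeFrobCompatibleAE ι π.1 ρ := by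
  sorry

/-- stub (LOCAL, hardest, rank 2): POTENTIAL DIAGONALISABILITY of the local restrictions in the crux's
situation.  For a number field `F`, a prime `p ≥ 5` unramified in `F`, `ρ : Γ_F → GL₂(ℚ̄_p)` and `v ∣ p`:
if `ρ|Γ_(F_v)` is de Rham for Fontaine's pinned datum with two distinct `τ`-labelled Hodge–Tate weights for
every `ℚ_p`-embedding `τ` of `F_v`, and residually absolutely irreducible (trace rendering), then compatible
crystalline extension data over the pinned datum exist and `ρ|Γ_(F_v)` is potentially diagonalisable for
each of them (Barnet-Lamb–Gee–Geraghty–Taylor 2014 §1.4: "could every crystalline representation be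
potentially diagonalizable?").  Known: all labelled gaps `≤ p` after the type-splitting base change
(Fontaine–Laffaille / Gao–Liu 2014 / Bartlett 2021 pseudo-Barsotti–Tate, any base field) and potentially
Barsotti–Tate (Gee–Kisin 2014 L.4.4.1); open beyond. -/
theorem stub_pdLocal : ∀ (F : Type) [Field F] [NumberField F] (p : ℕ) [Fact p.Prime], 5 ≤ p → ¬ ((p : ℤ) ∣ NumberField.discr F) → ∀ (ρ : Literature.NumberTheory.GaloisRepresentations.FramedGaloisRep F (PadicAlgCl p) 2) (v : IsDedekindDomain.HeightOneSpectrum (NumberField.RingOfIntegers F)) (hv : ((p : ℕ) : NumberField.RingOfIntegers F) ∈ v.asIdeal), ((Literature.NumberTheory.PAdicHodge.fontainePstAdicCompletion v p hv).IsDeRhamFramed (ρ.toLocal v) ∧ ∀ τ : @AlgHom ℚ_[p] (v.adicCompletion F) (PadicAlgCl p) _ _ _ (Literature.NumberTheory.PAdicHodge.fontainePstAdicCompletion v p hv).algebra _, (ρ.labelledHodgeTateWeightsAt v (Literature.NumberTheory.PAdicHodge.fontainePstAdicCompletion v p hv).algebra (Literature.NumberTheory.PAdicHodge.fontainePstAdicCompletion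 v p hv).𝔅 (@AlgHom.toRingHom ℚ_[p] (v.adicCompletion F) (PadicAlgCl p) _ _ _ (Literature.NumberTheory.PAdicHodge.fontainePstAdicCompletion v p hv).algebra _ τ)).Nodup ∧ Multiset.card (ρ.labelledHodgeTateWeightsAt v (Literature.NumberTheory.PAdicHodge.fontainePstAdicCompletion v p hv).algebra (Literature.NumberTheory.PAdicHodge.fontainePstAdicCompletion v p hv).𝔅 (@AlgHom.toRingHom ℚ_[p] (v.adicCompletion F) (PadicAlgCl p) _ _ _ (Literature.NumberTheory.PAdicHodge.fontainePstAdicCompletion v p hv).algebra _ τ)) = 2) → (¬ ∃ χ₁ χ₂ : Field.absoluteGaloisGroup (v.adicCompletion F) →* (PadicAlgCl p)ˣ, IsOpen (χ₁.ker : Set (Field.absoluteGaloisGroup (v.adicCompletion F))) ∧ IsOpen (χ₂.ker : Set (Field.absoluteGaloisGroup (v.adicCompletion F))) ∧ ∀ σ, ‖(ρ.toLocal v σ).val.trace - ((χ₁ σ : PadicAlgCl p) + (χ₂ σ : PadicAlgCl p))‖ < 1) → Nonempty (Literature.NumberTheory.GaloisRepresentations.PstCrystallineExtensionData (Literature.NumberTheory.PAdicHodge.fontainePstAdicCompletion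 v p hv)) ∧ ∀ 𝔈 : Literature.NumberTheory.GaloisRepresentations.PstCrystallineExtensionData (Literature.NumberTheory.PAdicHodge.fontainePstAdicCompletion v p hv), @Literature.NumberTheory.GaloisRepresentations.IsPotentiallyDiagonalizable p _ (v.adicCompletion F) _ (Literature.NumberTheory.PAdicHodge.fontainePstAdicCompletion v p hv).algebra 2 𝔈.𝔅 (ρ.toLocal v) := by
  sorry

/-- stub (GLOBAL, in print for `p ≥ 7`, rank 4): PD automorphy lifting — the crux with `7 ≤ p` and the
additional hypothesis that `ρ|Γ_(F_v)` is potentially diagonalisable at every `v ∣ p` (BLGGT 2014 Thm 4.2.1,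
potentially crystalline case, over totally real `F` by Dieulefait–Pacetti 2015 Thm 8.11; the residual
"potentially diagonalisably automorphic of level potentially prime to `p`" witness is manufactured from
plain residual modularity by a potentially Barsotti–Tate automorphic lift of tame type: Barnet-Lamb–Gee–
Geraghty MRL 20 (2013), Gee–Kisin 2014 Lemma 4.4.1, Breuil–Diamond 2014 Thm 3.2.2).  Not yet vendored:
the tree's `BLGGT2014_thm421_GL2_totallyReal` is the crystalline, PD-automorphic-witness form. -/
theorem stub_pdLift : ∀ (F : Type) [Field F] [NumberField F], NumberField.IsTotallyReal F → ∀ (p : ℕ) [Fact p.Prime], 7 ≤ p → ¬ ((p : ℤ) ∣ NumberField.discr F) → ∀ (hcpt : Literature.NumberTheory.Automorphic.isCompact_glFiniteIntegralLevel 2 F) (ι : PadicAlgCl p ≃+* ℂ) (ρ : Literature.NumberTheory.GaloisRepresentations.FramedGaloisRep F (PadicAlgCl p) 2), ρ.toGaloisRep.IsIrreducible → (∀ᶠ v : IsDedekindDomain.HeightOneSpectrum (NumberField.RingOfIntegers F) in Filter.cofinite, ρ.IsUnramifiedAt v) → ρ.IsOdd → (∀ (v : IsDedekindDomain.HeightOneSpectrum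 (NumberField.RingOfIntegers F)) (hv : ((p : ℕ) : NumberField.RingOfIntegers F) ∈ v.asIdeal), (Literature.NumberTheory.PAdicHodge.fontainePstAdicCompletion v p hv).IsDeRhamFramed (ρ.toLocal v) ∧ ∀ τ : @AlgHom ℚ_[p] (v.adicCompletion F) (PadicAlgCl p) _ _ _ (Literature.NumberTheory.PAdicHodge.fontainePstAdicCompletion v p hv).algebra _, (ρ.labelledHodgeTateWeightsAt v (Literature.NumberTheory.PAdicHodge.fontainePstAdicCompletion v p hv).algebra (Literature.NumberTheory.PAdicHodge.fontainePstAdicCompletion v p hv).𝔅 (@AlgHom.toRingHom ℚ_[p] (v.adicCompletion F) (PadicAlgCl p) _ _ _ (Literature.NumberTheory.PAdicHodge.fontainePstAdicCompletion v p hv).algebra _ τ)).Nodup ∧ Multiset.card (ρ.labelledHodgeTateWeightsAt v (Literature.NumberTheory.PAdicHodge.fontainePstAdicCompletion v p hv).algebra (Literature.NumberTheory.PAdicHodge.fontainePstAdicCompletion v p hv).𝔅 (@AlgHom.toRingHom ℚ_[p] (v.adicCompletion F) (PadicAlgCl p) _ _ _ (Literature.NumberTheory.PAdicHodge.fontainePstAdicCompletion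 v p hv).algebra _ τ)) = 2) → (∀ v : IsDedekindDomain.HeightOneSpectrum (NumberField.RingOfIntegers F), ((p : ℕ) : NumberField.RingOfIntegers F) ∈ v.asIdeal → ¬ ∃ χ₁ χ₂ : Field.absoluteGaloisGroup (v.adicCompletion F) →* (PadicAlgCl p)ˣ, IsOpen (χ₁.ker : Set (Field.absoluteGaloisGroup (v.adicCompletion F))) ∧ IsOpen (χ₂.ker : Set (Field.absoluteGaloisGroup (v.adicCompletion F))) ∧ ∀ σ, ‖(ρ.toLocal v σ).val.trace - ((χ₁ σ : PadicAlgCl p) + (χ₂ σ : PadicAlgCl p))‖ < 1) → (∀ (v : IsDedekindDomain.HeightOneSpectrum (NumberField.RingOfIntegers F)) (hv : ((p : ℕ) : NumberField.RingOfIntegers F) ∈ v.asIdeal), Nonempty (Literature.NumberTheory.GaloisRepresentations.PstCrystallineExtensionData (Literature.NumberTheory.PAdicHodge.fontainePstAdicCompletion v p hv)) ∧ ∀ 𝔈 : Literature.NumberTheory.GaloisRepresentations.PstCrystallineExtensionData (Literature.NumberTheory.PAdicHodge.fontainePstAdicCompletion v p hv), @Literature.NumberTheory.GaloisRepresentations.IsPotentiallyDiagonalizable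 p _ (v.adicCompletion F) _ (Literature.NumberTheory.PAdicHodge.fontainePstAdicCompletion v p hv).algebra 2 𝔈.𝔅 (ρ.toLocal v)) → (¬ ∃ χ₁ χ₂ : Field.absoluteGaloisGroup (CyclotomicField p F) →* (PadicAlgCl p)ˣ, IsOpen (χ₁.ker : Set (Field.absoluteGaloisGroup (CyclotomicField p F))) ∧ IsOpen (χ₂.ker : Set (Field.absoluteGaloisGroup (CyclotomicField p F))) ∧ ∀ σ, ‖(ρ.restrictField (CyclotomicField p F) σ).val.trace - ((χ₁ σ : PadicAlgCl p) + (χ₂ σ : PadicAlgCl p))‖ < 1) → (∃ (π₀ : Literature.NumberTheory.Automorphic.CuspidalAutomorphicRepData 2 F hcpt) (ρ₀ : Literature.NumberTheory.GaloisRepresentations.FramedGaloisRep F (PadicAlgCl p) 2), π₀.1.IsLAlgebraic ∧ (∃ T : Literature.NumberTheory.Automorphic.InfinityType F 2, π₀.1.HasInfinityType T ∧ T.IsRegular) ∧ Literature.NumberTheory.Automorphic.SatakeFrobCompatibleAE ι π₀.1 ρ₀ ∧ ∀ σ, ‖(ρ σ).val.trace - (ρ₀ σ).val.trace‖ < 1)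 → ∃ π : Literature.NumberTheory.Automorphic.CuspidalAutomorphicRepData 2 F hcpt, π.1.IsLAlgebraic ∧ (∃ T : Literature.NumberTheory.Automorphic.InfinityType F 2, π.1.HasInfinityType T ∧ T.IsRegular) ∧ Literature.NumberTheory.Automorphic.SatakeFrobCompatibleAE ι π.1 ρ := by
  sorry

/-- A prime `p ≥ 5` is `5` or at least `7`. [folklore] -/
theorem five_or_seven_le (p : ℕ) [hp : Fact p.Prime] (h5 : 5 ≤ p) : p = 5 ∨ 7 ≤ p := by
  rcases Nat.lt_or_ge p 7 with h | h
  · left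
    interval_cases p
    · rfl
    · exact absurd hp.out (by decide)
  · exact Or.inr h

/-- COMPOSITION (kernel-checked, sorry-free): the three stubs imply the crux `DeRhamLiftingIrred` BY NAME.
Case `p = 5`: `stub_pFive`.  Case `p ≥ 7`: `stub_pdLocal` supplies potential diagonalisability at every
`v ∣ p` from the crux's local hypotheses (de Rham regular + residually absolutely irreducible at `v`), and
`stub_pdLift` concludes. -/
theorem DeRhamLiftingIrred_of
    (hP5 : ∀ (F : Type) [Field F] [NumberField F], NumberField.IsTotallyReal F → ∀ (p : ℕ) [Fact p.Prime], p = 5 → ¬ ((p : ℤ) ∣ NumberField.discr F) → ∀ (hcpt : Literature.NumberTheory.Automorphic.isCompact_glFiniteIntegralLevel 2 F) (ι : PadicAlgCl p ≃+* ℂ) (ρ : Literature.NumberTheory.GaloisRepresentations.FramedGaloisRep F (PadicAlgCl p) 2), ρ.toGaloisRep.IsIrreducible → (∀ᶠ v : IsDedekindDomain.HeightOneSpectrum (NumberField.RingOfIntegers F) in Filter.cofinite, ρ.IsUnramifiedAt v) → ρ.IsOdd → (∀ (v : IsDedekindDomain.HeightOneSpectrum (NumberField.RingOfIntegers F)) (hv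 : ((p : ℕ) : NumberField.RingOfIntegers F) ∈ v.asIdeal), (Literature.NumberTheory.PAdicHodge.fontainePstAdicCompletion v p hv).IsDeRhamFramed (ρ.toLocal v) ∧ ∀ τ : @AlgHom ℚ_[p] (v.adicCompletion F) (PadicAlgCl p) _ _ _ (Literature.NumberTheory.PAdicHodge.fontainePstAdicCompletion v p hv).algebra _, (ρ.labelledHodgeTateWeightsAt v (Literature.NumberTheory.PAdicHodge.fontainePstAdicCompletion v p hv).algebra (Literature.NumberTheory.PAdicHodge.fontainePstAdicCompletion v p hv).𝔅 (@AlgHom.toRingHom ℚ_[p] (v.adicCompletion F) (PadicAlgCl p) _ _ _ (Literature.NumberTheory.PAdicHodge.fontainePstAdicCompletion v p hv).algebra _ τ)).Nodup ∧ Multiset.card (ρ.labelledHodgeTateWeightsAt v (Literature.NumberTheory.PAdicHodge.fontainePstAdicCompletion v p hv).algebra (Literature.NumberTheory.PAdicHodge.fontainePstAdicCompletion v p hv).𝔅 (@AlgHom.toRingHom ℚ_[p] (v.adicCompletion F) (PadicAlgCl p) _ _ _ (Literature.NumberTheory.PAdicHodge.fontainePstAdicCompletion v p hv).algebra _ τ))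 = 2) → (∀ v : IsDedekindDomain.HeightOneSpectrum (NumberField.RingOfIntegers F), ((p : ℕ) : NumberField.RingOfIntegers F) ∈ v.asIdeal → ¬ ∃ χ₁ χ₂ : Field.absoluteGaloisGroup (v.adicCompletion F) →* (PadicAlgCl p)ˣ, IsOpen (χ₁.ker : Set (Field.absoluteGaloisGroup (v.adicCompletion F))) ∧ IsOpen (χ₂.ker : Set (Field.absoluteGaloisGroup (v.adicCompletion F))) ∧ ∀ σ, ‖(ρ.toLocal v σ).val.trace - ((χ₁ σ : PadicAlgCl p) + (χ₂ σ : PadicAlgCl p))‖ < 1) → (¬ ∃ χ₁ χ₂ : Field.absoluteGaloisGroup (CyclotomicField p F) →* (PadicAlgCl p)ˣ, IsOpen (χ₁.ker : Set (Field.absoluteGaloisGroup (CyclotomicField p F))) ∧ IsOpen (χ₂.ker : Set (Field.absoluteGaloisGroup (CyclotomicField p F))) ∧ ∀ σ, ‖(ρ.restrictField (CyclotomicField p F) σ).val.trace - ((χ₁ σ : PadicAlgCl p) + (χ₂ σ : PadicAlgCl p))‖ < 1) → (∃ (π₀ : Literature.NumberTheory.Automorphic.CuspidalAutomorphicRepData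 2 F hcpt) (ρ₀ : Literature.NumberTheory.GaloisRepresentations.FramedGaloisRep F (PadicAlgCl p) 2), π₀.1.IsLAlgebraic ∧ (∃ T : Literature.NumberTheory.Automorphic.InfinityType F 2, π₀.1.HasInfinityType T ∧ T.IsRegular) ∧ Literature.NumberTheory.Automorphic.SatakeFrobCompatibleAE ι π₀.1 ρ₀ ∧ ∀ σ, ‖(ρ σ).val.trace - (ρ₀ σ).val.trace‖ < 1) → ∃ π : Literature.NumberTheory.Automorphic.CuspidalAutomorphicRepData 2 F hcpt, π.1.IsLAlgebraic ∧ (∃ T : Literature.NumberTheory.Automorphic.InfinityType F 2, π.1.HasInfinityType T ∧ T.IsRegular) ∧ Literature.NumberTheory.Automorphic.SatakeFrobCompatibleAE ι π.1 ρ)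
    (hPD : ∀ (F : Type) [Field F] [NumberField F] (p : ℕ) [Fact p.Prime], 5 ≤ p → ¬ ((p : ℤ) ∣ NumberField.discr F) → ∀ (ρ : Literature.NumberTheory.GaloisRepresentations.FramedGaloisRep F (PadicAlgCl p) 2) (v : IsDedekindDomain.HeightOneSpectrum (NumberField.RingOfIntegers F)) (hv : ((p : ℕ) : NumberField.RingOfIntegers F) ∈ v.asIdeal), ((Literature.NumberTheory.PAdicHodge.fontainePstAdicCompletion v p hv).IsDeRhamFramed (ρ.toLocal v) ∧ ∀ τ : @AlgHom ℚ_[p] (v.adicCompletion F) (PadicAlgCl p) _ _ _ (Literature.NumberTheory.PAdicHodge.fontainePstAdicCompletion v p hv).algebra _, (ρ.labelledHodgeTateWeightsAt v (Literature.NumberTheory.PAdicHodge.fontainePstAdicCompletion v p hv).algebra (Literature.NumberTheory.PAdicHodge.fontainePstAdicCompletion v p hv).𝔅 (@AlgHom.toRingHom ℚ_[p] (v.adicCompletion F) (PadicAlgCl p) _ _ _ (Literature.NumberTheory.PAdicHodge.fontainePstAdicCompletion v p hv).algebra _ τ)).Nodup ∧ Multiset.card (ρ.labelledHodgeTateWeightsAt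 v (Literature.NumberTheory.PAdicHodge.fontainePstAdicCompletion v p hv).algebra (Literature.NumberTheory.PAdicHodge.fontainePstAdicCompletion v p hv).𝔅 (@AlgHom.toRingHom ℚ_[p] (v.adicCompletion F) (PadicAlgCl p) _ _ _ (Literature.NumberTheory.PAdicHodge.fontainePstAdicCompletion v p hv).algebra _ τ)) = 2) → (¬ ∃ χ₁ χ₂ : Field.absoluteGaloisGroup (v.adicCompletion F) →* (PadicAlgCl p)ˣ, IsOpen (χ₁.ker : Set (Field.absoluteGaloisGroup (v.adicCompletion F))) ∧ IsOpen (χ₂.ker : Set (Field.absoluteGaloisGroup (v.adicCompletion F))) ∧ ∀ σ, ‖(ρ.toLocal v σ).val.trace - ((χ₁ σ : PadicAlgCl p) + (χ₂ σ : PadicAlgCl p))‖ < 1) → Nonempty (Literature.NumberTheory.GaloisRepresentations.PstCrystallineExtensionData (Literature.NumberTheory.PAdicHodge.fontainePstAdicCompletion v p hv)) ∧ ∀ 𝔈 : Literature.NumberTheory.GaloisRepresentations.PstCrystallineExtensionData (Literature.NumberTheory.PAdicHodge.fontainePstAdicCompletion v p hv), @Literature.NumberTheory.GaloisRepresentations.IsPotentiallyDiagonalizable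 p _ (v.adicCompletion F) _ (Literature.NumberTheory.PAdicHodge.fontainePstAdicCompletion v p hv).algebra 2 𝔈.𝔅 (ρ.toLocal v))
    (hLift : ∀ (F : Type) [Field F] [NumberField F], NumberField.IsTotallyReal F → ∀ (p : ℕ) [Fact p.Prime], 7 ≤ p → ¬ ((p : ℤ) ∣ NumberField.discr F) → ∀ (hcpt : Literature.NumberTheory.Automorphic.isCompact_glFiniteIntegralLevel 2 F) (ι : PadicAlgCl p ≃+* ℂ) (ρ : Literature.NumberTheory.GaloisRepresentations.FramedGaloisRep F (PadicAlgCl p) 2), ρ.toGaloisRep.IsIrreducible → (∀ᶠ v : IsDedekindDomain.HeightOneSpectrum (NumberField.RingOfIntegers F) in Filter.cofinite, ρ.IsUnramifiedAt v) → ρ.IsOdd → (∀ (v : IsDedekindDomain.HeightOneSpectrum (NumberField.RingOfIntegers F)) (hv : ((p : ℕ) : NumberField.RingOfIntegers F) ∈ v.asIdeal), (Literature.NumberTheory.PAdicHodge.fontainePstAdicCompletion v p hv).IsDeRhamFramed (ρ.toLocal v) ∧ ∀ τ : @AlgHom ℚ_[p] (v.adicCompletion F) (PadicAlgCl p) _ _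 _ (Literature.NumberTheory.PAdicHodge.fontainePstAdicCompletion v p hv).algebra _, (ρ.labelledHodgeTateWeightsAt v (Literature.NumberTheory.PAdicHodge.fontainePstAdicCompletion v p hv).algebra (Literature.NumberTheory.PAdicHodge.fontainePstAdicCompletion v p hv).𝔅 (@AlgHom.toRingHom ℚ_[p] (v.adicCompletion F) (PadicAlgCl p) _ _ _ (Literature.NumberTheory.PAdicHodge.fontainePstAdicCompletion v p hv).algebra _ τ)).Nodup ∧ Multiset.card (ρ.labelledHodgeTateWeightsAt v (Literature.NumberTheory.PAdicHodge.fontainePstAdicCompletion v p hv).algebra (Literature.NumberTheory.PAdicHodge.fontainePstAdicCompletion v p hv).𝔅 (@AlgHom.toRingHom ℚ_[p] (v.adicCompletion F) (PadicAlgCl p) _ _ _ (Literature.NumberTheory.PAdicHodge.fontainePstAdicCompletion v p hv).algebra _ τ)) = 2) → (∀ v : IsDedekindDomain.HeightOneSpectrum (NumberField.RingOfIntegers F), ((p : ℕ) : NumberField.RingOfIntegers F) ∈ v.asIdeal → ¬ ∃ χ₁ χ₂ : Field.absoluteGaloisGroup (v.adicCompletion F) →* (PadicAlgCl p)ˣ,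 IsOpen (χ₁.ker : Set (Field.absoluteGaloisGroup (v.adicCompletion F))) ∧ IsOpen (χ₂.ker : Set (Field.absoluteGaloisGroup (v.adicCompletion F))) ∧ ∀ σ, ‖(ρ.toLocal v σ).val.trace - ((χ₁ σ : PadicAlgCl p) + (χ₂ σ : PadicAlgCl p))‖ < 1) → (∀ (v : IsDedekindDomain.HeightOneSpectrum (NumberField.RingOfIntegers F)) (hv : ((p : ℕ) : NumberField.RingOfIntegers F) ∈ v.asIdeal), Nonempty (Literature.NumberTheory.GaloisRepresentations.PstCrystallineExtensionData (Literature.NumberTheory.PAdicHodge.fontainePstAdicCompletion v p hv)) ∧ ∀ 𝔈 : Literature.NumberTheory.GaloisRepresentations.PstCrystallineExtensionData (Literature.NumberTheory.PAdicHodge.fontainePstAdicCompletion v p hv), @Literature.NumberTheory.GaloisRepresentations.IsPotentiallyDiagonalizable p _ (v.adicCompletion F) _ (Literature.NumberTheory.PAdicHodge.fontainePstAdicCompletion v p hv).algebra 2 𝔈.𝔅 (ρ.toLocal v)) → (¬ ∃ χ₁ χ₂ : Field.absoluteGaloisGroup (CyclotomicField p F) →* (PadicAlgCl p)ˣ, IsOpen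 (χ₁.ker : Set (Field.absoluteGaloisGroup (CyclotomicField p F))) ∧ IsOpen (χ₂.ker : Set (Field.absoluteGaloisGroup (CyclotomicField p F))) ∧ ∀ σ, ‖(ρ.restrictField (CyclotomicField p F) σ).val.trace - ((χ₁ σ : PadicAlgCl p) + (χ₂ σ : PadicAlgCl p))‖ < 1) → (∃ (π₀ : Literature.NumberTheory.Automorphic.CuspidalAutomorphicRepData 2 F hcpt) (ρ₀ : Literature.NumberTheory.GaloisRepresentations.FramedGaloisRep F (PadicAlgCl p) 2), π₀.1.IsLAlgebraic ∧ (∃ T : Literature.NumberTheory.Automorphic.InfinityType F 2, π₀.1.HasInfinityType T ∧ T.IsRegular) ∧ Literature.NumberTheory.Automorphic.SatakeFrobCompatibleAE ι π₀.1 ρ₀ ∧ ∀ σ, ‖(ρ σ).val.trace - (ρ₀ σ).val.trace‖ < 1) → ∃ π : Literature.NumberTheory.Automorphic.CuspidalAutomorphicRepData 2 F hcpt, π.1.IsLAlgebraic ∧ (∃ T : Literature.NumberTheory.Automorphic.InfinityType F 2, π.1.HasInfinityType T ∧ T.IsRegular) ∧ Literature.NumberTheory.Automorphic.SatakeFrobCompatibleAE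 ι π.1 ρ) :
    Summit.Langlands.Langlands.Theses.EmbeddingNecklace.DeRhamLiftingIrred := by
  intro F _ _ hF p _ hp hdisc hcpt ι ρ hirr hunr hodd hdR hloc hcyc hmod
  rcases five_or_seven_le p hp with h5 | h7
  · exact hP5 F hF p h5 hdisc hcpt ι ρ hirr hunr hodd hdR hloc hcyc hmod
  · refine hLift F hF p h7 hdisc hcpt ι ρ hirr hunr hodd hdR hloc ?_ hcyc hmod
    intro v hv
    exact hPD F p hp hdisc ρ v hv (hdR v hv) (hloc v hv)

end Summit.Langlands.Langlands.Cruxes.DeRhamLiftingIrred.PdTransfer
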